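import Literature.RepresentationTheory.HeisenbergGroup.MetaplecticTopology
import Literature.RepresentationTheory.HeisenbergGroup.RankOneLocalSection
import HarnessLib

/-!
# Rank one: the congruence topology on `SL₂(F)`, the topology on `S̃p_ψ(F × F)`, and the open
compact subgroup fixing `1_𝒪` (MVW Chap. 2 II.8, II.10)

`F` a non-archimedean local field. We topologise the rank-one groups of the local Weil representation
(`RankOneLocalSection`) through `MetaplecticTopology`:

* §1 the principal congruence subgroups `K_m = {g ∈ SL₂(𝒪) | g ≡ 1 mod 𝔭^m}` of `Sp(F × F) = SL₂(F)`
  (`congruenceSp₁ F m`; `K_0 = SL₂(𝒪) = integralSp₁ F`), a decreasing chain with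
  `g K_{m+2D} g⁻¹ ⊆ K_m` when the entries of `g` lie in `𝔭^{-D}` (`conj_mem_congruenceSp₁`), i.e. a
  `CongruenceBasis` (`rankOneCongruenceBasis F`); the resulting (usual) group topology on `SL₂(F)` is
  registered as an instance.
* §2 the smooth-vector topology on `S̃p_ψ := MpPsi ρ_ψ` (instance), a topological group; the projection to
  `SL₂(F)` is continuous and **the Weil representation `MpPsi.toRep ρ_ψ` on `𝒮(F)` is smooth**
  (`isSmooth_toRep_rankOne`, MVW II.8).
* §3 for an unramified datum (`ψ` of conductor `𝒪`, `μ` self-dual, `2 ∈ 𝒪ˣ`): the compact subgroup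
  `unramifiedStabilizer μ hd` (the lift of `SL₂(𝒪)` fixing `1_𝒪`, `RankOneLocalSection` §3) **equals the basic
  open subgroup `U_{0,{1_𝒪}}`** — in particular it does not depend on `μ` — and **is open**
  (`isOpen_unramifiedStabilizer`, MVW II.10).

Together with `unramifiedVector_mem_fixedPoints` these are exactly the local hypotheses `IsOpen (Kc v)`,
`(r v).IsSmooth`, `1_{𝒪_v} ∈ fixedPoints (Kc v)` of the finite-adelic assembly
`Literature.NumberTheory.Automorphic.FiniteAdeleWeilAssembly.isSmooth_finiteAdeleRep`, for `G v = S̃p_{ψ_v}`.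
Everything is kernel-checked; MVW is cited for the objects, nothing is a record.
-/

set_option autoImplicit false

noncomputable section

namespace Literature.RepresentationTheory.HeisenbergGroup

open _root_.MeasureTheory
open Literature.NumberTheory.Automorphic
open Literature.NumberTheory.GaloisRepresentations.IsNonarchimedeanLocalField

variable {F : Type*} [Field F] [ValuativeRel F] [TopologicalSpace F] [IsNonarchimedeanLocalField F]

local notation "Sp₁" => symplecticGroup (polar (LinearMap.mul F F))

/-! ## §1 Principal congruence subgroups of `SL₂(F)` -/

section Congruence

/-- `a ≡ 1 mod 𝔭^m` (`m ≥ 0`) puts `a` in `𝒪`. [folklore] -/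
theorem mem_ball_zero_of_sub_one_mem {a : F} {m : ℕ} (h : a - 1 ∈ primePowBall F m) : a ∈ primePowBall F 0 := by
  have h' : a - 1 + 1 ∈ primePowBall F 0 :=
    add_mem_primePowBall (primePowBall_antitone (by exact_mod_cast m.zero_le) h) one_mem_ball_zero
  rwa [sub_add_cancel] at h'

/-- `𝔭^0 · 𝔭^m ⊆ 𝔭^m`. [folklore] -/
theorem ball_zero_mul_mem {x y : F} {m : ℕ} (hx : x ∈ primePowBall F 0) (hy : y ∈ primePowBall F m) :
    x * y ∈ primePowBall F m := by
  have h := mul_mem_primePowBall hx hy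
  rwa [zero_add] at h

/-- `𝔭^m · 𝔭^0 ⊆ 𝔭^m`. [folklore] -/
theorem mul_ball_zero_mem {x y : F} {m : ℕ} (hx : x ∈ primePowBall F m) (hy : y ∈ primePowBall F 0) :
    x * y ∈ primePowBall F m := by
  have h := mul_mem_primePowBall hx hy
  rwa [add_zero] at h

/-- `𝔭^m · 𝔭^m ⊆ 𝔭^m` (`m ≥ 0`). [folklore] -/
theorem mul_mem_of_mem_of_mem {x y : F} {m : ℕ} (hx : x ∈ primePowBall F m) (hy : y ∈ primePowBall F m) :
    x * y ∈ primePowBall F m :=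
  primePowBall_antitone (by omega) (mul_mem_primePowBall hx hy)

variable (F) in
/-- **the principal congruence subgroup** `K_m = {g ∈ SL₂(F) | a - 1, b, c, d - 1 ∈ 𝔭^m}` (`K_0 = SL₂(𝒪)`).
[cite: MoeglinVignerasWaldspurger1987, Chap. 2 II.10] -/
def congruenceSp₁ (m : ℕ) : Subgroup (symplecticGroup (polar (LinearMap.mul F F))) where
  carrier := {g | entryA g - 1 ∈ primePowBall F m ∧ entryB g ∈ primePowBall F m ∧
    entryC g ∈ primePowBall F m ∧ entryD g - 1 ∈ primePowBall F m}
  mul_mem' := by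
    rintro g h ⟨ha, hb, hc, hd⟩ ⟨ha', hb', hc', hd'⟩
    have ha0 := mem_ball_zero_of_sub_one_mem ha
    have hd0 := mem_ball_zero_of_sub_one_mem hd
    have ha0' := mem_ball_zero_of_sub_one_mem ha'
    have hd0' := mem_ball_zero_of_sub_one_mem hd'
    refine ⟨?_, ?_, ?_, ?_⟩
    · show entryA (g * h) - 1 ∈ _
      rw [entryA_mul, show entryA g * entryA h + entryB g * entryC h - 1
        = (entryA g - 1) * entryA h + (entryA h - 1) + entryB g * entryC h by ring]
      exact add_mem_primePowBall (add_mem_primePowBall (mul_ball_zero_mem ha ha0') ha') (mul_mem_of_mem_of_mem hb hc')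
    · show entryB (g * h) ∈ _
      rw [entryB_mul]
      exact add_mem_primePowBall (ball_zero_mul_mem ha0 hb') (mul_ball_zero_mem hb hd0')
    · show entryC (g * h) ∈ _
      rw [entryC_mul]
      exact add_mem_primePowBall (mul_ball_zero_mem hc ha0') (ball_zero_mul_mem hd0 hc')
    · show entryD (g * h) - 1 ∈ _
      rw [entryD_mul, show entryC g * entryB h + entryD g * entryD h - 1
        = entryC g * entryB h + (entryD g - 1) * entryD h + (entryD h - 1) by ring]
      exact add_mem_primePowBall (add_mem_primePowBall (mul_mem_of_mem_of_mem hc hb') (mul_ball_zero_mem hd hd0')) hd'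
  one_mem' := by
    refine ⟨?_, ?_, ?_, ?_⟩
    · show (1 : F) - 1 ∈ _
      rw [sub_self]; exact zero_mem_primePowBall _
    · show (0 : F) ∈ _
      exact zero_mem_primePowBall _
    · show (0 : F) ∈ _
      exact zero_mem_primePowBall _
    · show (1 : F) - 1 ∈ _
      rw [sub_self]; exact zero_mem_primePowBall _
  inv_mem' := by
    rintro g ⟨ha, hb, hc, hd⟩
    refine ⟨?_, ?_, ?_, ?_⟩
    · show entryA g⁻¹ - 1 ∈ _
      rw [entryA_inv]; exact hd
    · show entryB g⁻¹ ∈ _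
      rw [entryB_inv]; exact neg_mem_primePowBall hb
    · show entryC g⁻¹ ∈ _
      rw [entryC_inv]; exact neg_mem_primePowBall hc
    · show entryD g⁻¹ - 1 ∈ _
      rw [entryD_inv]; exact ha

/-- membership. [cite: MoeglinVignerasWaldspurger1987, Chap. 2 II.10] -/
theorem mem_congruenceSp₁ {m : ℕ} {g : Sp₁} :
    g ∈ congruenceSp₁ F m ↔ entryA g - 1 ∈ primePowBall F m ∧ entryB g ∈ primePowBall F m ∧
      entryC g ∈ primePowBall F m ∧ entryD g - 1 ∈ primePowBall F m := Iff.rfl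

/-- the chain decreases. [folklore] -/
theorem congruenceSp₁_antitone : Antitone (congruenceSp₁ F) := by
  intro m m' h g ⟨ha, hb, hc, hd⟩
  have h' : (m : ℤ) ≤ m' := by exact_mod_cast h
  exact ⟨primePowBall_antitone h' ha, primePowBall_antitone h' hb, primePowBall_antitone h' hc,
    primePowBall_antitone h' hd⟩

/-- `K_0 = SL₂(𝒪)`. [cite: MoeglinVignerasWaldspurger1987, Chap. 2 II.10] -/
theorem congruenceSp₁_zero : congruenceSp₁ F 0 = integralSp₁ F := by
  ext g
  rw [mem_congruenceSp₁, mem_integralSp₁, Nat.cast_zero]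
  constructor
  · rintro ⟨ha, hb, hc, hd⟩
    exact ⟨mem_ball_zero_of_sub_one_mem (m := 0) ha, hb, hc, mem_ball_zero_of_sub_one_mem (m := 0) hd⟩
  · rintro ⟨ha, hb, hc, hd⟩
    exact ⟨sub_mem_ball_zero ha one_mem_ball_zero, hb, hc, sub_mem_ball_zero hd one_mem_ball_zero⟩

/-- `K_m ≤ SL₂(𝒪)`. [folklore] -/
theorem congruenceSp₁_le_integralSp₁ (m : ℕ) : congruenceSp₁ F m ≤ integralSp₁ F := by
  rw [← congruenceSp₁_zero]
  exact congruenceSp₁_antitone m.zero_le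

/-- the entries of `g` lie in a common `𝔭^{-D}`. [folklore] -/
theorem exists_entries_mem (g : Sp₁) : ∃ D : ℕ, entryA g ∈ primePowBall F (-(D : ℤ)) ∧
    entryB g ∈ primePowBall F (-(D : ℤ)) ∧ entryC g ∈ primePowBall F (-(D : ℤ)) ∧ entryD g ∈ primePowBall F (-(D : ℤ)) := by
  obtain ⟨n₁, h₁⟩ := exists_mem_primePowBall (entryA g)
  obtain ⟨n₂, h₂⟩ := exists_mem_primePowBall (entryB g)
  obtain ⟨n₃, h₃⟩ := exists_mem_primePowBall (entryC g)
  obtain ⟨n₄, h₄⟩ := exists_mem_primePowBall (entryD g)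
  refine ⟨(-n₁).toNat + (-n₂).toNat + (-n₃).toNat + (-n₄).toNat, primePowBall_antitone ?_ h₁,
    primePowBall_antitone ?_ h₂, primePowBall_antitone ?_ h₃, primePowBall_antitone ?_ h₄⟩ <;> push_cast <;> omega

/-- `𝔭^{-D} 𝔭^{-D} 𝔭^{m+2D} ⊆ 𝔭^m`. [folklore] -/
theorem mul_mul_mem_of_mem {x y z : F} {D m : ℕ} (hx : x ∈ primePowBall F (-(D : ℤ))) (hy : y ∈ primePowBall F (-(D : ℤ)))
    (hz : z ∈ primePowBall F ((m + 2 * D : ℕ) : ℤ)) : x * y * z ∈ primePowBall F m := by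
  have h := mul_mem_primePowBall (mul_mem_primePowBall hx hy) hz
  have e : -(D : ℤ) + -(D : ℤ) + ((m + 2 * D : ℕ) : ℤ) = m := by push_cast; ring
  rwa [e] at h

/-- **conjugation compatibility**: if the entries of `g` lie in `𝔭^{-D}` then `g K_{m+2D} g⁻¹ ⊆ K_m`. [folklore] -/
theorem conj_mem_congruenceSp₁ {g : Sp₁} {D : ℕ} (hA : entryA g ∈ primePowBall F (-(D : ℤ)))
    (hB : entryB g ∈ primePowBall F (-(D : ℤ))) (hC : entryC g ∈ primePowBall F (-(D : ℤ)))
    (hD : entryD g ∈ primePowBall F (-(D : ℤ))) (m : ℕ) {x : Sp₁} (hx : x ∈ congruenceSp₁ F (m + 2 * D)) :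
    g * x * g⁻¹ ∈ congruenceSp₁ F m := by
  obtain ⟨ha, hb, hc, hd⟩ := hx
  have det := det_entries g
  refine ⟨?_, ?_, ?_, ?_⟩
  · rw [entryA_mul, entryA_mul, entryB_mul, entryA_inv, entryC_inv,
      show (entryA g * entryA x + entryB g * entryC x) * entryD g + (entryA g * entryB x + entryB g * entryD x) * -entryC g - 1
        = entryA g * entryD g * (entryA x - 1) + entryB g * entryD g * entryC x
          + -(entryA g * entryC g * entryB x) + -(entryB g * entryC g * (entryD x - 1)) by linear_combination det]
    exact add_mem_primePowBall (add_mem_primePowBall (add_mem_primePowBall (mul_mul_mem_of_mem hA hD ha)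
      (mul_mul_mem_of_mem hB hD hc)) (neg_mem_primePowBall (mul_mul_mem_of_mem hA hC hb)))
      (neg_mem_primePowBall (mul_mul_mem_of_mem hB hC hd))
  · rw [entryB_mul, entryA_mul, entryB_mul, entryB_inv, entryD_inv,
      show (entryA g * entryA x + entryB g * entryC x) * -entryB g + (entryA g * entryB x + entryB g * entryD x) * entryA g
        = entryA g * entryB g * (entryD x - 1) + -(entryA g * entryB g * (entryA x - 1))
          + entryA g * entryA g * entryB x + -(entryB g * entryB g * entryC x) by ring]
    exact add_mem_primePowBall (add_mem_primePowBall (add_mem_primePowBall (mul_mul_mem_of_mem hA hB hd)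
      (neg_mem_primePowBall (mul_mul_mem_of_mem hA hB ha))) (mul_mul_mem_of_mem hA hA hb))
      (neg_mem_primePowBall (mul_mul_mem_of_mem hB hB hc))
  · rw [entryC_mul, entryC_mul, entryD_mul, entryA_inv, entryC_inv,
      show (entryC g * entryA x + entryD g * entryC x) * entryD g + (entryC g * entryB x + entryD g * entryD x) * -entryC g
        = entryC g * entryD g * (entryA x - 1) + -(entryC g * entryD g * (entryD x - 1))
          + entryD g * entryD g * entryC x + -(entryC g * entryC g * entryB x) by ring]
    exact add_mem_primePowBall (add_mem_primePowBall (add_mem_primePowBall (mul_mul_mem_of_mem hC hD ha)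
      (neg_mem_primePowBall (mul_mul_mem_of_mem hC hD hd))) (mul_mul_mem_of_mem hD hD hc))
      (neg_mem_primePowBall (mul_mul_mem_of_mem hC hC hb))
  · rw [entryD_mul, entryC_mul, entryD_mul, entryB_inv, entryD_inv,
      show (entryC g * entryA x + entryD g * entryC x) * -entryB g + (entryC g * entryB x + entryD g * entryD x) * entryA g - 1
        = -(entryB g * entryC g * (entryA x - 1)) + -(entryB g * entryD g * entryC x)
          + entryA g * entryC g * entryB x + entryA g * entryD g * (entryD x - 1) by linear_combination det]
    exact add_mem_primePowBall (add_mem_primePowBall (add_mem_primePowBall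
      (neg_mem_primePowBall (mul_mul_mem_of_mem hB hC ha)) (neg_mem_primePowBall (mul_mul_mem_of_mem hB hD hc)))
      (mul_mul_mem_of_mem hA hC hb)) (mul_mul_mem_of_mem hA hD hd)

variable (F) in
/-- **the congruence basis `(K_m)` of `SL₂(F)`**. [cite: MoeglinVignerasWaldspurger1987, Chap. 2 II.10] -/
def rankOneCongruenceBasis : CongruenceBasis (symplecticGroup (polar (LinearMap.mul F F))) where
  K := congruenceSp₁ F
  antitone' := congruenceSp₁_antitone
  conj' g m := by
    obtain ⟨D, hA, hB, hC, hD⟩ := exists_entries_mem g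
    exact ⟨m + 2 * D, fun x hx => conj_mem_congruenceSp₁ hA hB hC hD m hx⟩

/-- its `m`-th member is `K_m`. [folklore] -/
@[simp] theorem rankOneCongruenceBasis_K (m : ℕ) : (rankOneCongruenceBasis F).K m = congruenceSp₁ F m := rfl

/-- **the topology of `SL₂(F)`**: the group topology with basis of neighbourhoods of `1` the `K_m`.
[cite: MoeglinVignerasWaldspurger1987, Chap. 2 II.10] -/
instance instTopologicalSpaceSp₁ : TopologicalSpace (symplecticGroup (polar (LinearMap.mul F F))) :=
  (rankOneCongruenceBasis F).topology

/-- `SL₂(F)` is a topological group. [folklore] -/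
instance instIsTopologicalGroupSp₁ : IsTopologicalGroup (symplecticGroup (polar (LinearMap.mul F F))) :=
  (rankOneCongruenceBasis F).isTopologicalGroup

/-- `K_m` is open in `SL₂(F)`. [folklore] -/
theorem isOpen_congruenceSp₁ (m : ℕ) : IsOpen (congruenceSp₁ F m : Set Sp₁) :=
  (rankOneCongruenceBasis F).isOpen_K m

/-- `SL₂(𝒪)` is open in `SL₂(F)`. [cite: MoeglinVignerasWaldspurger1987, Chap. 2 II.10] -/
theorem isOpen_integralSp₁ : IsOpen (integralSp₁ F : Set Sp₁) := by
  rw [← congruenceSp₁_zero]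
  exact isOpen_congruenceSp₁ 0

/-- the `K_m` are a basis of neighbourhoods of `1` in `SL₂(F)`. [folklore] -/
theorem nhds_one_hasBasis_congruenceSp₁ :
    (nhds (1 : Sp₁)).HasBasis (fun _ : ℕ => True) fun m => (congruenceSp₁ F m : Set Sp₁) :=
  (rankOneCongruenceBasis F).nhds_one_hasBasis

end Congruence

/-! ## §2 The topology on `S̃p_ψ(F × F)` and smoothness of the Weil representation -/

section Metaplectic

variable [Invertible (2 : F)] {ψ : AddChar F Circle}

/-- **the topology of `S̃p_ψ`**: the smooth-vector topology over the congruence basis of `SL₂(F)`.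
[cite: MoeglinVignerasWaldspurger1987, Chap. 2 II.8] -/
instance instTopologicalSpaceMpPsi {hψ : ψ.IsContinuousNontrivial} : TopologicalSpace (MpPsi (rhoPsi hψ)) :=
  MpPsi.topology (rankOneCongruenceBasis F) (rhoPsi hψ)

/-- `S̃p_ψ` is a topological group. [folklore] -/
instance instIsTopologicalGroupMpPsi {hψ : ψ.IsContinuousNontrivial} : IsTopologicalGroup (MpPsi (rhoPsi hψ)) :=
  MpPsi.isTopologicalGroup (rankOneCongruenceBasis F) (rhoPsi hψ)

/-- **the projection `S̃p_ψ → SL₂(F)` is continuous**. [cite: MoeglinVignerasWaldspurger1987, Chap. 2 II.1 (B)] -/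
theorem continuous_proj_rankOne (hψ : ψ.IsContinuousNontrivial) : Continuous (MpPsi.proj (rhoPsi hψ)) :=
  MpPsi.continuous_proj (rankOneCongruenceBasis F) (rhoPsi hψ)

/-- **the Weil representation of `S̃p_ψ` on `𝒮(F)` is smooth** (MVW II.8). [cite: MoeglinVignerasWaldspurger1987, Chap. 2 II.8] -/
theorem isSmooth_toRep_rankOne (hψ : ψ.IsContinuousNontrivial) : (MpPsi.toRep (rhoPsi hψ)).IsSmooth :=
  MpPsi.isSmooth_toRep (rankOneCongruenceBasis F) (rhoPsi hψ)

/-- every `f ∈ 𝒮(F)` is a smooth vector. [cite: MoeglinVignerasWaldspurger1987, Chap. 2 II.8] -/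
theorem isSmoothVector_toRep_rankOne (hψ : ψ.IsContinuousNontrivial) (f : SchwartzBruhat F) :
    (MpPsi.toRep (rhoPsi hψ)).IsSmoothVector f :=
  isSmooth_toRep_rankOne hψ f

/-- the basic open subgroups `U_{m,A}` of `S̃p_ψ` are open. [folklore] -/
theorem isOpen_smoothNhd_rankOne (hψ : ψ.IsContinuousNontrivial) (m : ℕ) (A : Finset (SchwartzBruhat F)) :
    IsOpen (MpPsi.smoothNhd (rankOneCongruenceBasis F) (rhoPsi hψ) m A : Set (MpPsi (rhoPsi hψ))) :=
  MpPsi.isOpen_smoothNhd (rankOneCongruenceBasis F) (rhoPsi hψ) m A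

end Metaplectic

/-! ## §3 The unramified compact open subgroup -/

section Unramified

variable [Invertible (2 : F)] [MeasurableSpace F] [BorelSpace F]
variable {ψ : AddChar F Circle} (μ : Measure F) [μ.IsAddHaarMeasure] (hd : UnramifiedDatum ψ μ)

include hd in
/-- **the lift of `SL₂(𝒪)` fixing `1_𝒪` is the basic subgroup `U_{0,{1_𝒪}}`** `= {(g, M) | g ∈ SL₂(𝒪), M 1_𝒪 = 1_𝒪}`
(uniqueness of implementers up to scalars); in particular it does not depend on `μ`. [cite: MoeglinVignerasWaldspurger1987, Chap. 2 II.10] -/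
theorem unramifiedStabilizer_eq_smoothNhd :
    unramifiedStabilizer μ hd = MpPsi.smoothNhd (rankOneCongruenceBasis F) (rhoPsi hd.cont) 0 {unramifiedVector F} := by
  ext p
  rw [mem_unramifiedStabilizer_iff, MpPsi.mem_smoothNhd, rankOneCongruenceBasis_K, congruenceSp₁_zero]
  constructor
  · rintro ⟨k, rfl⟩
    refine ⟨k.2, fun f hf => ?_⟩
    rw [Finset.mem_singleton] at hf
    subst hf
    exact localSection_unramifiedVector μ hd k.2
  · rintro ⟨hp, hfix⟩
    refine ⟨⟨_, hp⟩, Subtype.ext (Prod.ext rfl ?_)⟩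
    show localSection μ hd _ = (p : symplecticGroup (polar (LinearMap.mul F F)) × (SchwartzBruhat F ≃ₗ[ℂ] SchwartzBruhat F)).2
    rw [localSection_apply]
    exact (eq_localSectionFun μ hd hp ((mem_MpPsi _ _).1 p.2) (hfix _ (Finset.mem_singleton_self _))).symm

include hd in
/-- **`unramifiedStabilizer` is open in `S̃p_ψ`** (the compact open subgroup of MVW II.10). [cite: MoeglinVignerasWaldspurger1987, Chap. 2 II.10] -/
theorem isOpen_unramifiedStabilizer : IsOpen (unramifiedStabilizer μ hd : Set (MpPsi (rhoPsi hd.cont))) := by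
  rw [unramifiedStabilizer_eq_smoothNhd μ hd]
  exact isOpen_smoothNhd_rankOne hd.cont 0 {unramifiedVector F}

end Unramified

end Literature.RepresentationTheory.HeisenbergGroup
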